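import Mathlib.NumberTheory.JacobiSum.Basic
import HarnessLib

/-!
# `N(xⁿ = a)` by characters and the number of points on `xⁿ + yⁿ = 1` (Ireland–Rosen Ch. 8)

Let `F` be a finite field with `q` elements, `n ∣ q − 1`, and `χ` a multiplicative character of
`F` of exact order `n` with values in an integral domain `R`. Ireland–Rosen
[IrelandRosen1990, Prop. 8.1.5 and §8.4] prove (over `𝔽_p`; the proofs are verbatim over `𝔽_q`):

* **Prop. 8.1.5** `N(xⁿ = a) = Σ_{χⁿ = ε} χ(a) = Σ_{i=0}^{n−1} χ^i(a)` — `ε, χ, …, χ^{n−1}` being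
  the `n` characters of order dividing `n`;
* **§8.4** `N(xⁿ + yⁿ = 1) = Σ_{a+b=1} N(xⁿ = a) N(yⁿ = b) = Σ_{i,j=0}^{n−1} J(χ^j, χ^i)`, and,
  evaluating the terms with a trivial character or with `χ^i χ^j = ε` (Thm 1 of §8.3),
  `N(xⁿ + yⁿ = 1) = p + 1 − δ_n(−1)·n + Σ_{1 ≤ i,j ≤ n−1, i+j ≠ n} J(χ^i, χ^j)`, where
  `δ_n(−1) = 1` if `−1` is an `n`-th power and `0` otherwise (Prop. 8.4.1 is the resulting
  estimate `|N + δ_n(−1) n − (p+1)| ≤ (n−1)(n−2)√p`).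

Conventions: Mathlib's multiplicative characters send `0 ↦ 0`, including the trivial one
(`(1 : MulChar F R) 0 = 0`), whereas Ireland–Rosen put `ε(0) = 1`; accordingly Mathlib's
`jacobiSum 1 1 = q − 2` and `jacobiSum 1 χ = −1` (IR: `p` and `0`). We therefore state
Prop. 8.1.5 as `N(xⁿ = a) = [a = 0] + Σ_{i<n} χ^i(a)` and the double-sum form of §8.4 as
`N(xⁿ + yⁿ = 1) = 2n + Σ_{i,j<n} J(χ^i, χ^j)`; the final formula
`N = q + 1 − δ_n(−1) n + Σ_{1 ≤ i,j ≤ n−1, i+j ≠ n} J(χ^i, χ^j)` is convention-free and is proved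
exactly as printed (`card_fermatCurve_eq`).

Main statements (namespace `Literature.NumberTheory.GaussSums`):
* `card_nthPower_fibre` — for `a ≠ 0`, `#{x : xⁿ = a} = n` if `a` is an `n`-th power, else `0`
  (IR Prop. 4.2.1 with `d = (n, q−1) = n`);
* `apply_eq_one_iff_isNthPower` — for `χ` of order `n` and `a ≠ 0`: `χ a = 1 ↔ ∃ b, bⁿ = a`
  (IR Prop. 8.1.4);
* `card_nthPower_fibre_eq_sum_pow` — **IR Prop. 8.1.5** in the form used in §8.4;
* `card_fermatCurve_eq_sum_jacobiSum` — `N(xⁿ + yⁿ = 1) = 2n + Σ_{i,j<n} J(χ^i, χ^j)`;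
* `card_fermatCurve_eq` — **IR §8.4**: `N(xⁿ + yⁿ = 1) = q + 1 − δ·n + Σ'' J(χ^i, χ^j)`.
-/

namespace Literature.NumberTheory.GaussSums

open Finset Polynomial MulChar

section PowerResidues

variable {F : Type*} [Field F] [Fintype F] [DecidableEq F]

omit [DecidableEq F] in
/-- If `n ∣ q − 1` then `F` contains a primitive `n`-th root of unity (a suitable power of a
generator of the cyclic group `Fˣ`). [cite: IrelandRosen1990, Prop. 8.1.4 (proof)] -/
private theorem exists_isPrimitiveRoot_of_dvd_card_sub_one {n : ℕ} (hn : n ∣ Fintype.card F - 1) :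
    ∃ ζ : F, IsPrimitiveRoot ζ n := by
  classical
  obtain ⟨g, hg⟩ := IsCyclic.exists_ofOrder_eq_natCard (α := Fˣ)
  rw [Nat.card_eq_fintype_card, Fintype.card_units] at hg
  obtain ⟨m, hm⟩ := hn
  have hq : 0 < Fintype.card F - 1 := by
    have := Fintype.one_lt_card (α := F); omega
  have hprim : IsPrimitiveRoot g (Fintype.card F - 1) := hg ▸ IsPrimitiveRoot.orderOf g
  refine ⟨((g ^ m : Fˣ) : F), ?_⟩
  rw [IsPrimitiveRoot.coe_units_iff]
  exact hprim.pow hq (by rw [hm, mul_comm])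

omit [DecidableEq F] in
/-- `n ∣ q − 1` forces `0 < n` (as `q ≥ 2`). [folklore] -/
private theorem pos_of_dvd_card_sub_one {n : ℕ} (hn : n ∣ Fintype.card F - 1) : 0 < n := by
  rcases Nat.eq_zero_or_pos n with rfl | h
  · rw [zero_dvd_iff] at hn
    have := Fintype.one_lt_card (α := F); omega
  · exact h

/-- For `n ∣ q − 1` and `a ≠ 0`: the equation `xⁿ = a` has exactly `n` solutions in `F` if it has
one, and none otherwise (`d = (n, q−1) = n`). [cite: IrelandRosen1990, Prop. 4.2.1 / §8.1] -/
theorem card_nthPower_fibre {n : ℕ} (hn : n ∣ Fintype.card F - 1) {a : F} (ha : a ≠ 0) :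
    #{x : F | x ^ n = a} = if ∃ b : F, b ^ n = a then n else 0 := by
  obtain ⟨ζ, hζ⟩ := exists_isPrimitiveRoot_of_dvd_card_sub_one hn
  have hn0 : 0 < n := pos_of_dvd_card_sub_one hn
  have hset : ({x : F | x ^ n = a} : Finset F) = (nthRoots n a).toFinset := by
    ext x
    rw [mem_filter, Multiset.mem_toFinset, mem_nthRoots hn0]
    simp
  rw [hset, Multiset.toFinset_card_of_nodup (hζ.nthRoots_nodup ha), hζ.card_nthRoots]
  by_cases h : ∃ b : F, b ^ n = a <;> simp [h]

variable {R : Type*} [CommRing R] [IsDomain R]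

omit [DecidableEq F] [IsDomain R] in
/-- A character of exact order `n` takes the value `1` at `a ≠ 0` iff `a` is an `n`-th power
(`n ∣ q − 1`). [cite: IrelandRosen1990, Prop. 8.1.4] -/
theorem apply_eq_one_iff_isNthPower {n : ℕ} (hn : n ∣ Fintype.card F - 1) {χ : MulChar F R}
    (hχ : orderOf χ = n) {a : F} (ha : a ≠ 0) :
    χ a = 1 ↔ ∃ b : F, b ^ n = a := by
  classical
  have hn0 : 0 < n := pos_of_dvd_card_sub_one hn
  constructor
  · intro h1
    -- a generator `g` of `Fˣ`; as an element of `F` it is a primitive `(q-1)`-th root of unity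
    obtain ⟨g, hg⟩ := IsCyclic.exists_ofOrder_eq_natCard (α := Fˣ)
    rw [Nat.card_eq_fintype_card, Fintype.card_units] at hg
    have hgF : IsPrimitiveRoot (g : F) (Fintype.card F - 1) := by
      rw [IsPrimitiveRoot.coe_units_iff]; exact hg ▸ IsPrimitiveRoot.orderOf g
    haveI : NeZero (Fintype.card F - 1) :=
      ⟨by have := Fintype.one_lt_card (α := F); omega⟩
    have hpow : ∀ x : F, x ≠ 0 → ∃ i < Fintype.card F - 1, (g : F) ^ i = x := fun x hx =>
      hgF.eq_pow_of_pow_eq_one (FiniteField.pow_card_sub_one_eq_one x hx)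
    obtain ⟨i, -, hi⟩ := hpow a ha
    -- every unit is a power of `g`, so characters are determined by their value at `g`
    have hgen : ∀ x : Fˣ, x ∈ Subgroup.zpowers g := fun x => by
      obtain ⟨k, -, hk⟩ := hpow x x.ne_zero
      exact ⟨k, Units.ext (by simp [zpow_natCast, Units.val_pow_eq_pow_val, hk])⟩
    -- `ρ = χ g` is a primitive `n`-th root of unity in `R`
    set ρ : R := χ (g : F) with hρ
    have hρn : IsPrimitiveRoot ρ n := by
      refine ⟨?_, fun l hl => ?_⟩
      · rw [hρ, ← pow_apply_coe, ← hχ, pow_orderOf_eq_one, one_apply_coe]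
      · have hχl : χ ^ l = 1 := by
          rw [MulChar.eq_iff hgen, pow_apply_coe, one_apply_coe]
          exact hl
        exact hχ ▸ orderOf_dvd_of_pow_eq_one hχl
    -- `χ a = ρ ^ i = 1` forces `n ∣ i`
    have hρi : ρ ^ i = 1 := by
      rw [hρ, ← map_pow, hi, h1]
    obtain ⟨j, hj⟩ := hρn.dvd_of_pow_eq_one i hρi
    exact ⟨(g : F) ^ j, by rw [← pow_mul, mul_comm, ← hj, hi]⟩
  · rintro ⟨b, rfl⟩
    have hb : b ≠ 0 := by
      rintro rfl
      exact ha (zero_pow hn0.ne')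
    rw [map_pow, ← pow_apply' χ hn0.ne', ← hχ, pow_orderOf_eq_one,
      one_apply (isUnit_iff_ne_zero.mpr hb)]

omit [Fintype F] [DecidableEq F] [IsDomain R] in
/-- `(χ^i)(a) = χ(a)^i` for `a ≠ 0` (also for `i = 0`, as `a` is a unit). [folklore] -/
private theorem pow_apply_of_ne_zero (χ : MulChar F R) (i : ℕ) {a : F} (ha : a ≠ 0) :
    (χ ^ i) a = χ a ^ i := by
  simpa [Units.val_mk0] using pow_apply_coe χ i (Units.mk0 a ha)

omit [Fintype F] [DecidableEq F] [IsDomain R] in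
/-- Geometric sum of the values `χ^i(a)`, `i < n`, for `a ≠ 0` with `χ a = 1`: equal to `n`.
[cite: IrelandRosen1990, Prop. 8.1.5 (proof)] -/
theorem sum_pow_apply_of_eq_one {n : ℕ} (χ : MulChar F R) {a : F} (ha : a ≠ 0)
    (h1 : χ a = 1) : ∑ i ∈ range n, (χ ^ i) a = n := by
  simp [pow_apply_of_ne_zero χ _ ha, h1]

omit [Fintype F] [DecidableEq F] in
/-- Geometric sum of the values `χ^i(a)`, `i < n`, for `a ≠ 0` with `χ a ≠ 1`, `χ` of order `n`
(so `χ(a)ⁿ = 1` and `(χ(a) − 1)·Σ χ(a)^i = χ(a)ⁿ − 1 = 0`): equal to `0`.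
[cite: IrelandRosen1990, Prop. 8.1.5 (proof)] -/
theorem sum_pow_apply_of_ne_one {n : ℕ} {χ : MulChar F R} (hχ : orderOf χ = n) {a : F}
    (ha : a ≠ 0) (h1 : χ a ≠ 1) : ∑ i ∈ range n, (χ ^ i) a = 0 := by
  simp_rw [pow_apply_of_ne_zero χ _ ha]
  have hμn : χ a ^ n = 1 := by
    rw [← pow_apply_of_ne_zero χ n ha, ← hχ, pow_orderOf_eq_one,
      one_apply (isUnit_iff_ne_zero.mpr ha)]
  have hgeom : (∑ i ∈ range n, χ a ^ i) * (χ a - 1) = 0 := by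
    rw [geom_sum_mul, hμn, sub_self]
  exact (mul_eq_zero.mp hgeom).resolve_right (sub_ne_zero.mpr h1)

/-- **Ireland–Rosen Prop. 8.1.5** (in the form of §8.4: `χ` a character of exact order
`n ∣ q − 1`): `N(xⁿ = a) = Σ_{i=0}^{n−1} χ^i(a)` for `a ≠ 0`; with Mathlib's convention
`ε(0) = 0` the term `[a = 0]` restores IR's `ε(0) = 1` at `a = 0`.
[cite: IrelandRosen1990, Prop. 8.1.5] -/
theorem card_nthPower_fibre_eq_sum_pow {n : ℕ} (hn : n ∣ Fintype.card F - 1) {χ : MulChar F R}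
    (hχ : orderOf χ = n) (a : F) :
    (#{x : F | x ^ n = a} : R) = (if a = 0 then 1 else 0) + ∑ i ∈ range n, (χ ^ i) a := by
  have hn0 : 0 < n := pos_of_dvd_card_sub_one hn
  by_cases ha : a = 0
  · subst ha
    have h1 : ({x : F | x ^ n = 0} : Finset F) = {0} := by
      ext x; simp [pow_eq_zero_iff hn0.ne']
    have h2 : ∑ i ∈ range n, (χ ^ i) (0 : F) = 0 :=
      sum_eq_zero fun i _ => map_nonunit _ not_isUnit_zero
    rw [h1, h2, card_singleton, if_pos rfl]; simp
  · rw [if_neg ha, zero_add, card_nthPower_fibre hn ha]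
    by_cases hb : ∃ b : F, b ^ n = a
    · rw [if_pos hb, sum_pow_apply_of_eq_one χ ha ((apply_eq_one_iff_isNthPower hn hχ ha).mpr hb)]
    · rw [if_neg hb, Nat.cast_zero,
        sum_pow_apply_of_ne_one hχ ha (mt (apply_eq_one_iff_isNthPower hn hχ ha).mp hb)]

end PowerResidues

/-! ## The Fermat curve `xⁿ + yⁿ = 1` (Ireland–Rosen §8.4) -/

section Fermat

variable {F : Type*} [Field F] [Fintype F] [DecidableEq F]
variable {R : Type*} [CommRing R] [IsDomain R]

/-- `N(xⁿ + yⁿ = 1) = Σ_{a+b=1} N(xⁿ = a)·N(yⁿ = b)`.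
[cite: IrelandRosen1990, §8.4 (first display)] -/
theorem card_fermatCurve_eq_sum_fibres (n : ℕ) :
    #{p : F × F | p.1 ^ n + p.2 ^ n = 1} =
      ∑ a : F, #{x : F | x ^ n = a} * #{y : F | y ^ n = 1 - a} := by
  rw [card_filter, ← univ_product_univ, sum_product]
  have h1 : ∀ x : F, (∑ y : F, if x ^ n + y ^ n = 1 then 1 else 0) = #{y : F | y ^ n = 1 - x ^ n} :=
    fun x => by
    rw [card_filter]
    exact sum_congr rfl fun y _ =>
      if_congr ⟨fun h => by linear_combination h, fun h => by linear_combination h⟩ rfl rfl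
  simp_rw [h1]
  rw [← sum_fiberwise_of_maps_to (fun x (_ : x ∈ (univ : Finset F)) => mem_univ (x ^ n))
    (fun x => #{y : F | y ^ n = 1 - x ^ n})]
  refine sum_congr rfl fun a _ => ?_
  rw [sum_congr rfl fun x hx => by rw [(mem_filter.mp hx).2], sum_const, smul_eq_mul]

omit [Fintype F] [DecidableEq F] [IsDomain R] in
/-- `Σ_{i<n} χ^i(1) = n`. [folklore] -/
private theorem sum_pow_apply_one (χ : MulChar F R) (n : ℕ) :
    ∑ i ∈ range n, (χ ^ i) (1 : F) = n := by
  simp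

/-- **Ireland–Rosen §8.4, double-sum form** (Mathlib convention `ε(0) = 0`):
`N(xⁿ + yⁿ = 1) = 2n + Σ_{i,j=0}^{n−1} J(χ^i, χ^j)` for `χ` of exact order `n ∣ q − 1`
(IR, with `ε(0) = 1`: `Σ_{i,j} J(χ^j, χ^i)`; the `2n` is the convention shift in the terms with a
trivial character). [cite: IrelandRosen1990, §8.4 (second display)] -/
theorem card_fermatCurve_eq_sum_jacobiSum {n : ℕ} (hn : n ∣ Fintype.card F - 1)
    {χ : MulChar F R} (hχ : orderOf χ = n) :
    (#{p : F × F | p.1 ^ n + p.2 ^ n = 1} : R) =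
      2 * n + ∑ i ∈ range n, ∑ j ∈ range n, jacobiSum (χ ^ i) (χ ^ j) := by
  rw [card_fermatCurve_eq_sum_fibres, Nat.cast_sum]
  -- expand N(xⁿ = a)·N(yⁿ = 1 − a) by Prop. 8.1.5 into four terms
  have hterm : ∀ a : F, ((#{x : F | x ^ n = a} * #{y : F | y ^ n = 1 - a} : ℕ) : R)
      = (if a = 0 then if 1 - a = 0 then (1 : R) else 0 else 0)
        + (if a = 0 then ∑ j ∈ range n, (χ ^ j) (1 - a) else 0)
        + (if 1 - a = 0 then ∑ i ∈ range n, (χ ^ i) a else 0)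
        + (∑ i ∈ range n, (χ ^ i) a) * (∑ j ∈ range n, (χ ^ j) (1 - a)) := by
    intro a
    rw [Nat.cast_mul, card_nthPower_fibre_eq_sum_pow hn hχ a,
      card_nthPower_fibre_eq_sum_pow hn hχ (1 - a)]
    split_ifs <;> ring
  rw [sum_congr rfl fun a _ => hterm a, sum_add_distrib, sum_add_distrib, sum_add_distrib]
  -- the four sums
  have t1 : ∑ a : F, (if a = 0 then if 1 - a = 0 then (1 : R) else 0 else 0) = 0 := by
    refine sum_eq_zero fun a _ => ?_
    by_cases ha : a = 0
    · rw [if_pos ha, if_neg (by rw [ha, sub_zero]; exact one_ne_zero)]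
    · rw [if_neg ha]
  have t2 : ∑ a : F, (if a = 0 then ∑ j ∈ range n, (χ ^ j) (1 - a) else 0) = n := by
    rw [sum_ite_eq' univ (0 : F) (fun a => ∑ j ∈ range n, (χ ^ j) (1 - a)), if_pos (mem_univ _),
      sub_zero, sum_pow_apply_one]
  have t3 : ∑ a : F, (if 1 - a = 0 then ∑ i ∈ range n, (χ ^ i) a else 0) = n := by
    have h : ∀ a : F, (if 1 - a = 0 then ∑ i ∈ range n, (χ ^ i) a else 0)
        = (if (1 : F) = a then ∑ i ∈ range n, (χ ^ i) a else 0) :=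
      fun a => if_congr sub_eq_zero rfl rfl
    simp_rw [h]
    rw [sum_ite_eq univ (1 : F) (fun a => ∑ i ∈ range n, (χ ^ i) a), if_pos (mem_univ _),
      sum_pow_apply_one]
  have t4 : ∑ a : F, (∑ i ∈ range n, (χ ^ i) a) * (∑ j ∈ range n, (χ ^ j) (1 - a))
      = ∑ i ∈ range n, ∑ j ∈ range n, jacobiSum (χ ^ i) (χ ^ j) := by
    simp_rw [sum_mul_sum]
    rw [sum_comm]
    refine sum_congr rfl fun i _ => ?_
    rw [sum_comm]
    exact sum_congr rfl fun j _ => rfl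
  rw [t1, t2, t3, t4]
  ring

omit [Fintype F] [DecidableEq F] [IsDomain R] in
/-- `Σ_{i<n} f i = f 0 + Σ_{0<i<n} f i` for `0 < n`. [folklore] -/
private theorem sum_range_eq_add_sum_Ioo (f : ℕ → R) {n : ℕ} (hn : 0 < n) :
    ∑ i ∈ range n, f i = f 0 + ∑ i ∈ Ioo 0 n, f i := by
  have hr : range n = insert 0 (Ioo 0 n) := by
    ext i; simp only [mem_range, mem_insert, mem_Ioo]; omega
  rw [hr, sum_insert (by simp)]

omit [Fintype F] [DecidableEq F] [IsDomain R] in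
/-- `Σ_{0<j<n} f j = f (n − i) + Σ_{0<j<n, i+j ≠ n} f j` for `0 < i < n`. [folklore] -/
private theorem sum_Ioo_eq_add_sum_filter (f : ℕ → R) {n i : ℕ} (hi : i ∈ Ioo 0 n) :
    ∑ j ∈ Ioo 0 n, f j = f (n - i) + ∑ j ∈ Ioo 0 n with i + j ≠ n, f j := by
  rw [mem_Ioo] at hi
  have hmem : n - i ∈ Ioo 0 n := by rw [mem_Ioo]; omega
  have hflt : (Ioo 0 n).filter (fun j => i + j ≠ n) = (Ioo 0 n).erase (n - i) := by
    rw [← filter_ne']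
    refine filter_congr fun j hj => ?_
    rw [mem_Ioo] at hj
    omega
  rw [hflt, add_sum_erase _ _ hmem]

/-- **Ireland–Rosen §8.4** (third display; the count behind Prop. 8.4.1): for `n ∣ q − 1` and `χ`
a character of exact order `n`,
`N(xⁿ + yⁿ = 1) = q + 1 − δ_n(−1)·n + Σ_{1 ≤ i,j ≤ n−1, i+j ≠ n} J(χ^i, χ^j)`,
where `δ_n(−1) = 1` if `−1` is an `n`-th power in `F` and `0` otherwise (the `δ_n(−1)·n` "points
at infinity"). The `(n−1)(n−2)` Jacobi sums in the double sum all have `χ^i, χ^j, χ^iχ^j ≠ ε`.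
[cite: IrelandRosen1990, §8.4 (display before Prop. 8.4.1)] -/
theorem card_fermatCurve_eq {n : ℕ} (hn : n ∣ Fintype.card F - 1) {χ : MulChar F R}
    (hχ : orderOf χ = n) :
    (#{p : F × F | p.1 ^ n + p.2 ^ n = 1} : R) =
      Fintype.card F + 1 - (if ∃ b : F, b ^ n = -1 then (n : R) else 0)
        + ∑ i ∈ Ioo 0 n, ∑ j ∈ Ioo 0 n with i + j ≠ n, jacobiSum (χ ^ i) (χ ^ j) := by
  have hn0 : 0 < n := pos_of_dvd_card_sub_one hn
  have hχn : χ ^ n = 1 := hχ ▸ pow_orderOf_eq_one χ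
  have hne : ∀ i ∈ Ioo 0 n, χ ^ i ≠ 1 := fun i hi => by
    rw [mem_Ioo] at hi
    exact pow_ne_one_of_lt_orderOf (by omega) (by omega)
  set J : ℕ → ℕ → R := fun i j => jacobiSum (χ ^ i) (χ ^ j) with hJ
  -- values of the special Jacobi sums
  have hJ00 : J 0 0 = Fintype.card F - 2 := by
    simp only [hJ, pow_zero]; exact jacobiSum_one_one
  have hJ0j : ∀ j ∈ Ioo 0 n, J 0 j = -1 := fun j hj => by
    simp only [hJ, pow_zero]; exact jacobiSum_one_nontrivial (hne j hj)
  have hJi0 : ∀ i ∈ Ioo 0 n, J i 0 = -1 := fun i hi => by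
    simp only [hJ, pow_zero]; rw [jacobiSum_comm]; exact jacobiSum_one_nontrivial (hne i hi)
  have hJinv : ∀ i ∈ Ioo 0 n, J i (n - i) = -(χ ^ i) (-1) := fun i hi => by
    have hi' := mem_Ioo.mp hi
    have hinv : χ ^ (n - i) = (χ ^ i)⁻¹ := by
      refine (inv_eq_of_mul_eq_one_right ?_).symm
      rw [← pow_add, Nat.add_sub_cancel' hi'.2.le, hχn]
    simp only [hJ]; rw [hinv]; exact jacobiSum_nontrivial_inv (hne i hi)
  -- the character sum at −1
  have hSm1 : ∑ i ∈ range n, (χ ^ i) (-1 : F) = if ∃ b : F, b ^ n = -1 then (n : R) else 0 := by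
    have hm1 : (-1 : F) ≠ 0 := neg_ne_zero.mpr one_ne_zero
    split_ifs with hb
    · exact sum_pow_apply_of_eq_one χ hm1 ((apply_eq_one_iff_isNthPower hn hχ hm1).mpr hb)
    · exact sum_pow_apply_of_ne_one hχ hm1 (mt (apply_eq_one_iff_isNthPower hn hχ hm1).mp hb)
  have hSm1' : ∑ i ∈ Ioo 0 n, (χ ^ i) (-1 : F) =
      (if ∃ b : F, b ^ n = -1 then (n : R) else 0) - 1 := by
    rw [← hSm1, sum_range_eq_add_sum_Ioo (fun i => (χ ^ i) (-1 : F)) hn0, pow_zero,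
      one_apply (isUnit_iff_ne_zero.mpr (neg_ne_zero.mpr one_ne_zero))]
    ring
  -- decompose the double sum
  have hcard : (#(Ioo 0 n) : R) = n - 1 := by
    rw [Nat.card_Ioo, Nat.sub_zero, Nat.cast_pred hn0]
  have hD : ∑ i ∈ range n, ∑ j ∈ range n, J i j
      = (Fintype.card F - 2) - (n - 1) - (n - 1) - ∑ i ∈ Ioo 0 n, (χ ^ i) (-1 : F)
        + ∑ i ∈ Ioo 0 n, ∑ j ∈ Ioo 0 n with i + j ≠ n, J i j := by
    rw [sum_range_eq_add_sum_Ioo _ hn0, sum_range_eq_add_sum_Ioo _ hn0, hJ00,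
      sum_congr rfl hJ0j, sum_const, nsmul_eq_mul, mul_neg, mul_one, hcard]
    have hrow : ∀ i ∈ Ioo 0 n, ∑ j ∈ range n, J i j
        = -1 + (-(χ ^ i) (-1 : F) + ∑ j ∈ Ioo 0 n with i + j ≠ n, J i j) := fun i hi => by
      rw [sum_range_eq_add_sum_Ioo _ hn0, hJi0 i hi, sum_Ioo_eq_add_sum_filter _ hi, hJinv i hi]
    rw [sum_congr rfl hrow, sum_add_distrib, sum_add_distrib, sum_const, nsmul_eq_mul, mul_neg,
      mul_one, hcard, sum_neg_distrib]
    ring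
  rw [card_fermatCurve_eq_sum_jacobiSum hn hχ]
  change 2 * (n : R) + ∑ i ∈ range n, ∑ j ∈ range n, J i j = _
  rw [hD, hSm1']
  ring

end Fermat

end Literature.NumberTheory.GaussSums
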